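import Literature.Analysis.FluidPDE.EulerReynoldsMollification
import Literature.Analysis.FluidPDE.AntidivergenceLinear
import Literature.Analysis.FluidPDE.NavierStokesCorrectorAntidivergence
import Literature.Analysis.FunctionSpaces.TorusMollifierEstimates
import HarnessLib

/-!
# Perturbing a Navier–Stokes–Reynolds solution: the abstract bookkeeping step

Analysis/FluidPDE support file (all results proved) for the convex-integration step of
A. Cheskidov, X. Luo, *Sharp nonuniqueness for the Navier–Stokes equations*, Invent. Math. 229
(2022) = arXiv:2009.06596, §4 (Prop. 4.1, Lemmas 4.5–4.6): the part of the verification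
"`(u + w, p₁, R₁)` solves the Navier–Stokes–Reynolds system" that does not depend on the shape
of the perturbation `w`.

Let `(u, P, R)` solve the NSR system (`Torus.IsNSReynoldsOn`, viscosity `1`) on `[0, T] × 𝕋^d`,
`d ≥ 2`, and let `w` be a jointly smooth, divergence-free perturbation of zero mean. Suppose the
problem-specific algebra has produced jointly smooth fields `S₁` (a symmetric tensor, by columns),
`q` (a scalar) and `f` (a vector field) with

  `∂ₜw + div (w ⊗ w) + div R = div S₁ + ∇q + f`   on `[0, T] × 𝕋^d`   (⋆)

(CL22, Lemma 4.5 is an identity of this shape). Then (`IsNSReynoldsOn.perturb`) the triple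
`(u + w, perturbedPressure, perturbedStress)` solves the NSR system on `[0, T]`, where
(CL22, Lemma 4.6: `R₁ = R_lin + R_cor + R_osc`, `p₁ = p + P`)

* `perturbedStress = S̊₁ + (u ⊗ w + w ⊗ u)˚ - (∇w + ∇wᵀ) + ℛ f` — the linear term
  `(u·∇)w + (w·∇)u = div (u ⊗ w + w ⊗ u)` and the dissipative term `Δw = div (∇w + ∇wᵀ)`
  (`div w = 0`) are kept as explicit symmetric tensors (CL22 routes them through `ℛ`, Lemma 5.6;
  here no Calderón–Zygmund bound is needed for them), traces are moved into the pressure, and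
  only the remainder `f` goes through the De Lellis–Székelyhidi antidivergence `ℛ`
  (`Torus.antidivergence`, CL22 Def. 7.2), using `div ℛ f = f - ⨍ f` and `⨍ f = 0`, which
  follows from (⋆) by integrating over the torus;
* `perturbedPressure = P - q - tr(S₁ + u ⊗ w + w ⊗ u)/d + (its mean)`.

Also recorded: symmetry/trace/smoothness of the pieces, the pointwise bounds
`‖Å‖ ≤ 2‖A‖`, `‖u ⊗ w + w ⊗ u‖ ≤ 2‖u‖‖w‖`, `‖∇w + ∇wᵀ‖ ≤ 2 ∑ᵢ ‖∂ᵢw‖`, `‖R₁‖ ≤ …`, and the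
vanishing of the new stress at times where `w`, `S₁`, `f` vanish (well-preparedness, CL22
Lemma 4.6).

## Mathlib / tree search

Reused: `Torus.tensorProd`, `tensorDivergence_tensorProd`, `tensorDivergence_add_apply`,
`laplacian_add_apply`, `convect_add_left/right`, `gradient_add_apply`, `IsDivFree.add`,
`HasZeroMean.add`, `hasZeroMean_sub_integral`, `IsSmoothSpaceTimeOn.integral_const`
(`NavierStokesConcentrationTools`); `Torus.traceless`, `tensorTrace`, `traceless_symm`,
`sum_traceless_apply_apply`, `tensorDivergence_traceless`, `IsSmoothSpaceTimeOn.traceless`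
(`EulerReynoldsMollification`); `Torus.antidivergence`, `tensorDivergence_antidivergence`,
`antidivergence_symm`, `antidivergence_trace`, `IsSmoothSpaceTimeOn.antidivergence`
(`Antidivergence`), `antidivergence_zero` (`AntidivergenceLinear`);
`isSmoothSpaceTimeOn_of_columns` (`NavierStokesCorrectorAntidivergence`);
`IsSmoothSpaceTimeOn.column` (`EulerReynolds`); `integral_partialDeriv_eq_zero_holds`, `IsSmoothSpaceTimeOn.hasDerivWithinAt_integral`
(`TorusCalculusProofs`); `integral_gradient_eq_zero` (`TorusConvolution`); `gradient_apply`
(`TorusMollifierEstimates`).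
`lean search 'symGrad|linStress|perturbedStress|norm_traceless_le'` finds no prior versions.

## References

* A. Cheskidov, X. Luo, arXiv:2009.06596, §2.1 (2.1), §4.5 Lemmas 4.5–4.6, §7.2 Def. 7.2.
  [`CheskidovLuo2022`]
* C. De Lellis, L. Székelyhidi Jr., *Dissipative continuous Euler flows*, Invent. Math. 193
  (2013), §4.1 (the operator `ℛ`).
-/

open MeasureTheory Set Filter Topology
open scoped InnerProductSpace ContDiff ENNReal

noncomputable section

namespace Literature.Analysis.FluidPDE

namespace Torus

open Literature.Analysis.FunctionSpaces.Torus (proj stLift lift IsSmooth IsContDiff laplacian divergence IsDivFree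
  HasZeroMean isSmooth_const isContDiff_const isSmoothSpaceTimeOn_const)

variable {d : Type*} [Fintype d] [DecidableEq d]

/-! ## Three tensor constructions -/

section Tensors

/-- The **symmetrised gradient tensor** `∇w + ∇wᵀ` of a vector field, by columns:
column `j` is `∂ⱼw + ∇wⱼ`, i.e. the `(i, j)` entry is `∂ⱼwᵢ + ∂ᵢwⱼ`. For divergence-free `w`,
`div (∇w + ∇wᵀ) = Δw` (`tensorDivergence_symGrad`). [folklore] -/
def symGrad (w : UnitAddTorus d → EuclideanSpace ℝ d) : UnitAddTorus d → d → EuclideanSpace ℝ d :=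
  fun y j => FunctionSpaces.Torus.partialDeriv j w y + FunctionSpaces.Torus.gradient (fun z => w z j) y

/-- The **linear stress** `u ⊗ w + w ⊗ u` of a perturbation `w` of a background `u`, by columns
(`(i, j)` entry `wᵢuⱼ + uᵢwⱼ`); for divergence-free `u`, `w`,
`div (u ⊗ w + w ⊗ u) = (u·∇)w + (w·∇)u` (CL22, §4.5, the term `div(ū ⊗ w + w ⊗ ū)` of
`R_lin`). [cite: CheskidovLuo2022, §4.5 Lemma 4.6] -/
def linStress (u w : UnitAddTorus d → EuclideanSpace ℝ d) : UnitAddTorus d → d → EuclideanSpace ℝ d :=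
  fun y j => tensorProd w u y j + tensorProd u w y j

variable (A : UnitAddTorus d → d → EuclideanSpace ℝ d) (u w : UnitAddTorus d → EuclideanSpace ℝ d)

omit [DecidableEq d] in
/-- Any entry is bounded by the column-sup norm. [folklore] -/
theorem abs_apply_apply_le (T : d → EuclideanSpace ℝ d) (i j : d) : |T j i| ≤ ‖T‖ :=
  ((Real.norm_eq_abs _).symm.le.trans (PiLp.norm_apply_le (T j) i)).trans (norm_le_pi_norm T j)

/-- Pointwise bound `‖Å(y)‖ ≤ 2‖A(y)‖` (column-sup norm). [folklore] -/
theorem norm_traceless_le (y : UnitAddTorus d) : ‖traceless A y‖ ≤ 2 * ‖A y‖ := by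
  refine (pi_norm_le_iff_of_nonneg (by positivity)).2 fun j => ?_
  simp only [traceless, tensorTrace]
  have h1 : ‖A y j‖ ≤ ‖A y‖ := norm_le_pi_norm (A y) j
  have h2 : ‖((∑ i, A y i i) / Fintype.card d) • EuclideanSpace.single j (1 : ℝ)‖ ≤ ‖A y‖ := by
    rw [norm_smul, PiLp.norm_single, norm_one, mul_one, norm_div, Real.norm_natCast]
    rcases Nat.eq_zero_or_pos (Fintype.card d) with h0 | hpos
    · exact absurd (Fintype.card_pos_iff.2 ⟨j⟩) (by omega)
    rw [div_le_iff₀ (by exact_mod_cast hpos)]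
    calc ‖∑ i, A y i i‖ ≤ ∑ i, ‖A y i i‖ := norm_sum_le _ _
      _ ≤ ∑ _i : d, ‖A y‖ := Finset.sum_le_sum fun i _ => (Real.norm_eq_abs _).le.trans (abs_apply_apply_le (A y) i i)
      _ = ‖A y‖ * Fintype.card d := by rw [Finset.sum_const, Finset.card_univ, nsmul_eq_mul, mul_comm]
  calc ‖A y j - ((∑ i, A y i i) / Fintype.card d) • EuclideanSpace.single j (1 : ℝ)‖
      ≤ ‖A y j‖ + ‖((∑ i, A y i i) / Fintype.card d) • EuclideanSpace.single j (1 : ℝ)‖ := norm_sub_le _ _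
    _ ≤ ‖A y‖ + ‖A y‖ := add_le_add h1 h2
    _ = 2 * ‖A y‖ := by ring

omit [Fintype d] [DecidableEq d] in
/-- Entries of the linear stress: `wᵢuⱼ + uᵢwⱼ`. [folklore] -/
@[simp]
theorem linStress_apply (y : UnitAddTorus d) (i j : d) :
    linStress u w y j i = w y i * u y j + u y i * w y j := by
  simp [linStress]

omit [Fintype d] [DecidableEq d] in
/-- The linear stress is symmetric. [folklore] -/
theorem linStress_symm (y : UnitAddTorus d) (i j : d) : linStress u w y i j = linStress u w y j i := by
  rw [linStress_apply, linStress_apply]; ring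

omit [DecidableEq d] in
/-- Pointwise bound `‖(u ⊗ w + w ⊗ u)(y)‖ ≤ 2‖u(y)‖‖w(y)‖`. [folklore] -/
theorem norm_linStress_le (y : UnitAddTorus d) : ‖linStress u w y‖ ≤ 2 * ‖u y‖ * ‖w y‖ := by
  refine (pi_norm_le_iff_of_nonneg (by positivity)).2 fun j => ?_
  simp only [linStress, tensorProd]
  have h1 : ‖u y j • w y‖ ≤ ‖u y‖ * ‖w y‖ := by
    rw [norm_smul]; exact mul_le_mul_of_nonneg_right (PiLp.norm_apply_le (u y) j) (norm_nonneg _)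
  have h2 : ‖w y j • u y‖ ≤ ‖u y‖ * ‖w y‖ := by
    rw [norm_smul, mul_comm]; exact mul_le_mul_of_nonneg_left (PiLp.norm_apply_le (w y) j) (norm_nonneg _)
  calc ‖u y j • w y + w y j • u y‖ ≤ ‖u y j • w y‖ + ‖w y j • u y‖ := norm_add_le _ _
    _ ≤ ‖u y‖ * ‖w y‖ + ‖u y‖ * ‖w y‖ := add_le_add h1 h2
    _ = 2 * ‖u y‖ * ‖w y‖ := by ring

/-- Entries of the symmetrised gradient: `∂ⱼwᵢ + ∂ᵢwⱼ` (`C¹` fields). [folklore] -/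
theorem symGrad_apply {w} (hw : IsContDiff 1 w) (y : UnitAddTorus d) (i j : d) :
    symGrad w y j i = FunctionSpaces.Torus.partialDeriv j (fun z => w z i) y + FunctionSpaces.Torus.partialDeriv i (fun z => w z j) y := by
  have hwj : IsContDiff 1 (fun z => w z j) := (EuclideanSpace.proj j : EuclideanSpace ℝ d →L[ℝ] ℝ).contDiff.comp hw
  simp only [symGrad, PiLp.add_apply]
  rw [FunctionSpaces.Torus.gradient_apply hwj, ← FunctionSpaces.Torus.partialDeriv_apply_coord hw j y i]

/-- The symmetrised gradient is symmetric. [folklore] -/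
theorem symGrad_symm {w} (hw : IsContDiff 1 w) (y : UnitAddTorus d) (i j : d) :
    symGrad w y i j = symGrad w y j i := by
  rw [symGrad_apply hw, symGrad_apply hw, add_comm]

/-- The trace of the symmetrised gradient is `2 div w`. [folklore] -/
theorem symGrad_trace {w} (hw : IsContDiff 1 w) (y : UnitAddTorus d) :
    ∑ i, symGrad w y i i = 2 * divergence w y := by
  simp_rw [symGrad_apply hw, ← two_mul]
  rw [← Finset.mul_sum]; rfl

omit [DecidableEq d] in
/-- The Euclidean norm is bounded by the sum of the coordinates' absolute values (private copy;
public versions, to be collapsed by a librarian: `norm_le_sum_abs_apply` of `NSFourierAPriori`,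
`Torus.norm_le_sum_abs` of `OnsagerBDSVProofs`, neither in this import closure). [folklore] -/
private theorem norm_le_sum_abs_apply (x : EuclideanSpace ℝ d) : ‖x‖ ≤ ∑ i, |x i| := by
  have hS : 0 ≤ ∑ i, |x i| := Finset.sum_nonneg fun i _ => abs_nonneg _
  rw [EuclideanSpace.norm_eq, Real.sqrt_le_left hS, sq, Finset.sum_mul]
  refine Finset.sum_le_sum fun i _ => ?_
  rw [Real.norm_eq_abs, sq]
  exact mul_le_mul_of_nonneg_left (Finset.single_le_sum (f := fun j => |x j|) (fun j _ => abs_nonneg _)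
    (Finset.mem_univ i)) (abs_nonneg _)

/-- Pointwise bound `‖(∇w + ∇wᵀ)(y)‖ ≤ 2 ∑ᵢ ‖∂ᵢw(y)‖` (`C¹` fields). [folklore] -/
theorem norm_symGrad_le {w} (hw : IsContDiff 1 w) (y : UnitAddTorus d) :
    ‖symGrad w y‖ ≤ 2 * ∑ i, ‖FunctionSpaces.Torus.partialDeriv i w y‖ := by
  refine (pi_norm_le_iff_of_nonneg (by positivity)).2 fun j => ?_
  have hwj : IsContDiff 1 (fun z => w z j) := (EuclideanSpace.proj j : EuclideanSpace ℝ d →L[ℝ] ℝ).contDiff.comp hw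
  simp only [symGrad]
  have h1 : ‖FunctionSpaces.Torus.partialDeriv j w y‖ ≤ ∑ i, ‖FunctionSpaces.Torus.partialDeriv i w y‖ :=
    Finset.single_le_sum (f := fun i => ‖FunctionSpaces.Torus.partialDeriv i w y‖) (fun i _ => norm_nonneg _) (Finset.mem_univ j)
  have h2 : ‖FunctionSpaces.Torus.gradient (fun z => w z j) y‖ ≤ ∑ i, ‖FunctionSpaces.Torus.partialDeriv i w y‖ := by
    refine (norm_le_sum_abs_apply _).trans (Finset.sum_le_sum fun i _ => ?_)
    rw [FunctionSpaces.Torus.gradient_apply hwj, FunctionSpaces.Torus.partialDeriv_apply_coord hw]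
    exact (Real.norm_eq_abs _).symm.le.trans (PiLp.norm_apply_le _ _)
  calc ‖FunctionSpaces.Torus.partialDeriv j w y + FunctionSpaces.Torus.gradient (fun z => w z j) y‖
      ≤ ‖FunctionSpaces.Torus.partialDeriv j w y‖ + ‖FunctionSpaces.Torus.gradient (fun z => w z j) y‖ := norm_add_le _ _
    _ ≤ _ := by linarith

end Tensors

/-! ## Smoothness -/

section Smooth

variable {S : Set ℝ}

omit [DecidableEq d] in
/-- The linear stress of jointly smooth fields is jointly smooth. [folklore] -/
theorem _root_.Literature.Analysis.FunctionSpaces.Torus.IsSmoothSpaceTimeOn.linStress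
    {u w : ℝ → UnitAddTorus d → EuclideanSpace ℝ d} (hu : FunctionSpaces.Torus.IsSmoothSpaceTimeOn S u)
    (hw : FunctionSpaces.Torus.IsSmoothSpaceTimeOn S w) : FunctionSpaces.Torus.IsSmoothSpaceTimeOn S (fun t => linStress (u t) (w t)) :=
  isSmoothSpaceTimeOn_of_columns fun j => ((hu.apply j).smul hw).add ((hw.apply j).smul hu)

/-- The symmetrised gradient of a jointly smooth field is jointly smooth (time sets of unique
differentiability). [folklore] -/
theorem _root_.Literature.Analysis.FunctionSpaces.Torus.IsSmoothSpaceTimeOn.symGrad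
    {w : ℝ → UnitAddTorus d → EuclideanSpace ℝ d} (hw : FunctionSpaces.Torus.IsSmoothSpaceTimeOn S w) (hS : UniqueDiffOn ℝ S) :
    FunctionSpaces.Torus.IsSmoothSpaceTimeOn S (fun t => symGrad (w t)) :=
  isSmoothSpaceTimeOn_of_columns fun j => (hw.partialDeriv hS j).add ((hw.apply j).gradient hS)

omit [DecidableEq d] in
/-- Slices: the linear stress of smooth fields is smooth. [folklore] -/
theorem _root_.Literature.Analysis.FunctionSpaces.Torus.IsSmooth.linStress
    {u w : UnitAddTorus d → EuclideanSpace ℝ d} (hu : IsSmooth u) (hw : IsSmooth w) :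
    IsSmooth (linStress u w) :=
  ((isSmoothSpaceTimeOn_const hu (univ : Set ℝ)).linStress (isSmoothSpaceTimeOn_const hw univ)).isSmooth_slice
    (mem_univ (0 : ℝ))

/-- Slices: the symmetrised gradient of a smooth field is smooth. [folklore] -/
theorem _root_.Literature.Analysis.FunctionSpaces.Torus.IsSmooth.symGrad
    {w : UnitAddTorus d → EuclideanSpace ℝ d} (hw : IsSmooth w) : IsSmooth (symGrad w) :=
  ((isSmoothSpaceTimeOn_const hw (univ : Set ℝ)).symGrad uniqueDiffOn_univ).isSmooth_slice (mem_univ (0 : ℝ))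

end Smooth

/-! ## Divergences and integrals -/

section Divergence

/-- **`div (u ⊗ w + w ⊗ u) = (u·∇)w + (w·∇)u`** for smooth divergence-free `u`, `w`. [folklore] -/
theorem tensorDivergence_linStress {u w : UnitAddTorus d → EuclideanSpace ℝ d} (hu : IsSmooth u)
    (hw : IsSmooth w) (hdu : IsDivFree u) (hdw : IsDivFree w) (y : UnitAddTorus d) :
    tensorDivergence (linStress u w) y = FunctionSpaces.Torus.convect u w y + FunctionSpaces.Torus.convect w u y := by
  unfold linStress
  rw [tensorDivergence_add_apply ((hw.tensorProd hu).isContDiff (by simp)) ((hu.tensorProd hw).isContDiff (by simp)),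
    tensorDivergence_tensorProd hw hu, tensorDivergence_tensorProd hu hw, hdu y, hdw y]
  simp

/-- **`div (∇w + ∇wᵀ) = Δw`** for smooth divergence-free `w`
(`∑ⱼ ∂ⱼ∂ⱼw = Δw` and `∑ⱼ ∂ⱼ∂ᵢwⱼ = ∂ᵢ div w = 0`). [folklore] -/
theorem tensorDivergence_symGrad {w : UnitAddTorus d → EuclideanSpace ℝ d} (hw : IsSmooth w)
    (hdw : IsDivFree w) (y : UnitAddTorus d) : tensorDivergence (symGrad w) y = laplacian w y := by
  have h1 : ∀ {f : UnitAddTorus d → EuclideanSpace ℝ d}, IsSmooth f → IsContDiff 1 f := fun hf => hf.isContDiff (by simp)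
  have h1' : ∀ {f : UnitAddTorus d → ℝ}, IsSmooth f → IsContDiff 1 f := fun hf => hf.isContDiff (by simp)
  unfold symGrad tensorDivergence
  have hsplit : ∀ j, FunctionSpaces.Torus.partialDeriv j (fun z => FunctionSpaces.Torus.partialDeriv j w z + FunctionSpaces.Torus.gradient (fun x => w x j) z) y =
      FunctionSpaces.Torus.partialDeriv j (FunctionSpaces.Torus.partialDeriv j w) y + FunctionSpaces.Torus.partialDeriv j (FunctionSpaces.Torus.gradient fun x => w x j) y := fun j =>
    partialDeriv_add_apply (h1 (hw.partialDeriv j)) (h1 (hw.apply j).gradient) j y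
  simp_rw [hsplit]
  rw [Finset.sum_add_distrib, ← FunctionSpaces.Torus.laplacian_eq_sum_partialDeriv_partialDeriv hw, add_eq_left]
  -- `∑ⱼ ∂ⱼ ∇wⱼ = ∇ div w = 0`, coordinatewise
  ext i
  rw [show (∑ j, FunctionSpaces.Torus.partialDeriv j (FunctionSpaces.Torus.gradient fun x => w x j) y) i =
      ∑ j, FunctionSpaces.Torus.partialDeriv j (FunctionSpaces.Torus.gradient fun x => w x j) y i from by simp [Finset.sum_apply]]
  have h2 : ∀ j, FunctionSpaces.Torus.partialDeriv j (FunctionSpaces.Torus.gradient fun x => w x j) y i =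
      FunctionSpaces.Torus.partialDeriv i (FunctionSpaces.Torus.partialDeriv j fun x => w x j) y := by
    intro j
    rw [← FunctionSpaces.Torus.partialDeriv_apply_coord (h1 (hw.apply j).gradient) j y i]
    have h3 : (fun z => FunctionSpaces.Torus.gradient (fun x => w x j) z i) = FunctionSpaces.Torus.partialDeriv i fun x => w x j :=
      funext fun z => FunctionSpaces.Torus.gradient_apply (h1' (hw.apply j)) z i
    rw [h3, FunctionSpaces.Torus.partialDeriv_comm (hw.apply j)]
  simp_rw [h2]
  rw [← FunctionSpaces.Torus.partialDeriv_finset_sum Finset.univ (fun j _ => h1' ((hw.apply j).partialDeriv j))]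
  have h4 : (fun z => ∑ j ∈ Finset.univ, FunctionSpaces.Torus.partialDeriv j (fun x => w x j) z) = fun _ => (0 : ℝ) :=
    funext fun z => hdw z
  rw [h4, partialDeriv_const_apply]
  rfl

/-- `∫ div A = 0` over the torus for a smooth tensor field (private copy of
`Torus.integral_tensorDivergence` of `OnsagerBDSVGluedTriple`, not in this import closure; to be
collapsed by a librarian). [folklore] -/
private theorem integral_tensorDivergence_eq_zero {A : UnitAddTorus d → d → EuclideanSpace ℝ d} (hA : IsSmooth A) :
    ∫ y, tensorDivergence A y = 0 := by
  unfold tensorDivergence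
  rw [integral_finsetSum _ fun j _ => ((hA.column j).partialDeriv j).integrable]
  exact Finset.sum_eq_zero fun j _ => FunctionSpaces.Torus.integral_partialDeriv_eq_zero_holds (hA.column j) j

omit [DecidableEq d] in
/-- `∫ ∂ₜw = 0` at every time of a convex time set of unique differentiability, for a jointly
smooth field of zero mean at all times (differentiate `∫ w = 0` under the integral). [folklore] -/
theorem integral_timeDerivWithin_eq_zero {S : Set ℝ} {w : ℝ → UnitAddTorus d → EuclideanSpace ℝ d}
    (hw : FunctionSpaces.Torus.IsSmoothSpaceTimeOn S w) (hS : Convex ℝ S) (hU : UniqueDiffOn ℝ S)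
    (hmean : ∀ t ∈ S, HasZeroMean (w t)) {t : ℝ} (ht : t ∈ S) :
    ∫ y, FunctionSpaces.Torus.timeDerivWithin S w t y = 0 := by
  have h1 := hw.hasDerivWithinAt_integral hS ht
  have h2 : HasDerivWithinAt (fun s => ∫ y, w s y) 0 S t :=
    (hasDerivWithinAt_const t S (0 : EuclideanSpace ℝ d)).congr (fun s hs => hmean s hs) (hmean t ht)
  rw [← h1.derivWithin (hU t ht), h2.derivWithin (hU t ht)]

end Divergence

/-! ## The perturbed triple -/

section Perturb

variable (u w : ℝ → UnitAddTorus d → EuclideanSpace ℝ d) (P q : ℝ → UnitAddTorus d → ℝ)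
  (S₁ : ℝ → UnitAddTorus d → d → EuclideanSpace ℝ d) (f : ℝ → UnitAddTorus d → EuclideanSpace ℝ d)

/-- **The new Reynolds stress** of the perturbed triple:
`R₁ = S̊₁ + (u ⊗ w + w ⊗ u)˚ - (∇w + ∇wᵀ) + ℛ f` (CL22, Lemma 4.6: `R₁ = R_lin + R_cor + R_osc`,
with the linear and dissipative parts kept explicit, see the file header). [cite: CheskidovLuo2022, §4.5 Lemma 4.6] -/
def perturbedStress : ℝ → UnitAddTorus d → d → EuclideanSpace ℝ d :=
  fun t y j => traceless (S₁ t) y j + traceless (linStress (u t) (w t)) y j - symGrad (w t) y j +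
    antidivergence (f t) y j

/-- The scalar moved into the pressure: `q + tr(S₁ + u ⊗ w + w ⊗ u)/d`. [folklore] -/
def pressureShift : ℝ → UnitAddTorus d → ℝ :=
  fun t y => q t y + (tensorTrace (S₁ t) y / Fintype.card d + tensorTrace (linStress (u t) (w t)) y / Fintype.card d)

/-- **The new pressure** `p₁ = P - (q + tr(S₁ + u ⊗ w + w ⊗ u)/d) + mean` (CL22, Lemma 4.6:
`p₁ = p + P`, normalised to zero mean). [cite: CheskidovLuo2022, §4.5 Lemma 4.6] -/
def perturbedPressure : ℝ → UnitAddTorus d → ℝ :=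
  fun t y => P t y - (pressureShift u w q S₁ t y - ∫ z, pressureShift u w q S₁ t z)

variable {u w P q S₁ f} {T : ℝ} {R : ℝ → UnitAddTorus d → d → EuclideanSpace ℝ d}

omit [DecidableEq d] in
/-- Smoothness of the pressure shift. [folklore] -/
theorem isSmoothSpaceTimeOn_pressureShift {S : Set ℝ} (hu : FunctionSpaces.Torus.IsSmoothSpaceTimeOn S u)
    (hw : FunctionSpaces.Torus.IsSmoothSpaceTimeOn S w) (hq : FunctionSpaces.Torus.IsSmoothSpaceTimeOn S q) (hS : FunctionSpaces.Torus.IsSmoothSpaceTimeOn S S₁) :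
    FunctionSpaces.Torus.IsSmoothSpaceTimeOn S (pressureShift u w q S₁) := by
  have htr : ∀ {A : ℝ → UnitAddTorus d → d → EuclideanSpace ℝ d}, FunctionSpaces.Torus.IsSmoothSpaceTimeOn S A →
      FunctionSpaces.Torus.IsSmoothSpaceTimeOn S (fun t x => tensorTrace (A t) x / Fintype.card d) := fun hA =>
    hA.tensorTrace.mul (isSmoothSpaceTimeOn_const (FunctionSpaces.Torus.isSmooth_const _) S)
  exact hq.add ((htr hS).add (htr (hu.linStress hw)))

/-- **The abstract perturbation step.** Let `(u, P, R)` solve the Navier–Stokes–Reynolds system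
on `[0, T] × 𝕋^d` (`T > 0`, `d ≥ 2`), let `w` be jointly smooth, divergence free and of zero
mean, and let jointly smooth `S₁` (symmetric), `q`, `f` satisfy
`∂ₜw + div (w ⊗ w) + div R = div S₁ + ∇q + f` on `[0, T] × 𝕋^d`. Then
`(u + w, perturbedPressure, perturbedStress)` solves the NSR system on `[0, T]`
(CL22, §4.5: Lemma 4.5 supplies the identity, Lemma 4.6 concludes "`(u₁, p₁, R₁)` is a smooth
solution of (2.1)"; here with `(u·∇)w + (w·∇)u = div(u ⊗ w + w ⊗ u)`, `Δw = div(∇w + ∇wᵀ)`,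
`div ℛf = f - ⨍f` and `⨍f = 0` by integrating the identity). [cite: CheskidovLuo2022, §4.5 Lemmas 4.5–4.6] -/
theorem IsNSReynoldsOn.perturb (hd : 2 ≤ Fintype.card d) (hT : 0 < T)
    (h : IsNSReynoldsOn (Icc 0 T) 1 u P R)
    (hw : FunctionSpaces.Torus.IsSmoothSpaceTimeOn (Icc 0 T) w) (hwdiv : ∀ t ∈ Icc 0 T, IsDivFree (w t))
    (hwmean : ∀ t ∈ Icc 0 T, HasZeroMean (w t))
    (hS : FunctionSpaces.Torus.IsSmoothSpaceTimeOn (Icc 0 T) S₁) (hSsym : ∀ t ∈ Icc 0 T, ∀ y, ∀ i j : d, S₁ t y i j = S₁ t y j i)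
    (hq : FunctionSpaces.Torus.IsSmoothSpaceTimeOn (Icc 0 T) q) (hf : FunctionSpaces.Torus.IsSmoothSpaceTimeOn (Icc 0 T) f)
    (hid : ∀ t ∈ Icc 0 T, ∀ y, FunctionSpaces.Torus.timeDerivWithin (Icc 0 T) w t y + tensorDivergence (tensorProd (w t) (w t)) y +
      tensorDivergence (R t) y = tensorDivergence (S₁ t) y + FunctionSpaces.Torus.gradient (q t) y + f t y) :
    IsNSReynoldsOn (Icc 0 T) 1 (fun t y => u t y + w t y) (perturbedPressure u w P q S₁)
      (perturbedStress u w S₁ f) := by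
  haveI : Nonempty d := Fintype.card_pos_iff.1 (by omega)
  have hU : UniqueDiffOn ℝ (Icc 0 T) := uniqueDiffOn_Icc hT
  have hc : Convex ℝ (Icc 0 T) := convex_Icc 0 T
  have hint : (interior (Icc 0 T)).Nonempty := by rw [interior_Icc]; exact nonempty_Ioo.2 hT
  have hu := h.smooth_velocity
  have hsh := isSmoothSpaceTimeOn_pressureShift hu hw hq hS
  -- zero mean of `f`
  have hfmean : ∀ t ∈ Icc 0 T, ∫ y, f t y = 0 := by
    intro t ht
    have hwt : IsSmooth (w t) := hw.isSmooth_slice ht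
    have hRt : IsSmooth (R t) := h.smooth_stress.isSmooth_slice ht
    have hSt : IsSmooth (S₁ t) := hS.isSmooth_slice ht
    have hqt : IsSmooth (q t) := hq.isSmooth_slice ht
    have heq : f t = (FunctionSpaces.Torus.timeDerivWithin (Icc 0 T) w t + tensorDivergence (tensorProd (w t) (w t)) +
        tensorDivergence (R t)) - tensorDivergence (S₁ t) - FunctionSpaces.Torus.gradient (q t) := by
      funext y; simp only [Pi.add_apply, Pi.sub_apply]; rw [hid t ht y]; abel
    have i1 : Integrable (fun y => FunctionSpaces.Torus.timeDerivWithin (Icc 0 T) w t y) volume := ((hw.timeDerivWithin hU).isSmooth_slice ht).integrable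
    have i2 : Integrable (tensorDivergence (tensorProd (w t) (w t))) volume := (hwt.tensorProd hwt).tensorDivergence.integrable
    have i3 : Integrable (tensorDivergence (R t)) volume := hRt.tensorDivergence.integrable
    have i4 : Integrable (tensorDivergence (S₁ t)) volume := hSt.tensorDivergence.integrable
    have i5 : Integrable (FunctionSpaces.Torus.gradient (q t)) volume := hqt.gradient.integrable
    rw [heq, integral_sub' ((((i1.add i2).add i3).sub i4)) i5, integral_sub' ((i1.add i2).add i3) i4,
      integral_add' (i1.add i2) i3, integral_add' i1 i2]
    change (∫ y, FunctionSpaces.Torus.timeDerivWithin (Icc 0 T) w t y) + (∫ y, tensorDivergence (tensorProd (w t) (w t)) y) +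
      (∫ y, tensorDivergence (R t) y) - (∫ y, tensorDivergence (S₁ t) y) - (∫ y, FunctionSpaces.Torus.gradient (q t) y) = 0
    rw [integral_timeDerivWithin_eq_zero hw hc hU hwmean ht, integral_tensorDivergence_eq_zero (hwt.tensorProd hwt),
      integral_tensorDivergence_eq_zero hRt, integral_tensorDivergence_eq_zero hSt, FunctionSpaces.Torus.integral_gradient_eq_zero hqt]
    simp
  refine
    { smooth_velocity := hu.add hw
      smooth_pressure := h.smooth_pressure.sub (hsh.sub (hsh.integral_const hU hc))
      smooth_stress := ?_
      momentum := ?_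
      divFree := fun t ht => IsDivFree.add ((hu.isSmooth_slice ht).isContDiff (by simp))
        ((hw.isSmooth_slice ht).isContDiff (by simp)) (h.divFree t ht) (hwdiv t ht)
      symm := ?_
      traceFree := ?_
      hasZeroMean_pressure := ?_ }
  · -- smoothness of the stress
    have h1 := (hS.traceless).add ((hu.linStress hw).traceless)
    have h2 := (h1.sub (hw.symGrad hU)).add (hf.antidivergence hc hint)
    exact h2
  · -- momentum
    intro t ht y
    have hut : IsSmooth (u t) := hu.isSmooth_slice ht
    have hwt : IsSmooth (w t) := hw.isSmooth_slice ht
    have hPt : IsSmooth (P t) := h.smooth_pressure.isSmooth_slice ht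
    have hSt : IsSmooth (S₁ t) := hS.isSmooth_slice ht
    have hft : IsSmooth (f t) := hf.isSmooth_slice ht
    have hsht : IsSmooth (pressureShift u w q S₁ t) := hsh.isSmooth_slice ht
    have h1u : IsContDiff 1 (u t) := hut.isContDiff (by simp)
    have h1w : IsContDiff 1 (w t) := hwt.isContDiff (by simp)
    -- time derivative
    have eDt : FunctionSpaces.Torus.timeDerivWithin (Icc 0 T) (fun t y => u t y + w t y) t y =
        FunctionSpaces.Torus.timeDerivWithin (Icc 0 T) u t y + FunctionSpaces.Torus.timeDerivWithin (Icc 0 T) w t y :=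
      ((hu.hasDerivWithinAt_slice ht y).add (hw.hasDerivWithinAt_slice ht y)).derivWithin (hU t ht)
    -- Laplacian, convective term, pressure gradient
    have eLap : laplacian (fun y => u t y + w t y) y = laplacian (u t) y + laplacian (w t) y :=
      laplacian_add_apply hut hwt y
    have eConv : FunctionSpaces.Torus.convect (fun y => u t y + w t y) (fun y => u t y + w t y) y =
        FunctionSpaces.Torus.convect (u t) (u t) y + FunctionSpaces.Torus.convect (u t) (w t) y + (FunctionSpaces.Torus.convect (w t) (u t) y + FunctionSpaces.Torus.convect (w t) (w t) y) := by
      rw [convect_add_left, convect_add_right _ h1u h1w, convect_add_right _ h1u h1w]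
    have hshm : IsContDiff 1 (fun y => pressureShift u w q S₁ t y - ∫ z, pressureShift u w q S₁ t z) :=
      (hsht.sub (FunctionSpaces.Torus.isSmooth_const _)).isContDiff (by simp)
    have eGrad : FunctionSpaces.Torus.gradient (perturbedPressure u w P q S₁ t) y =
        FunctionSpaces.Torus.gradient (P t) y - FunctionSpaces.Torus.gradient (pressureShift u w q S₁ t) y := by
      have e1 : perturbedPressure u w P q S₁ t = fun y => P t y + (-1 : ℝ) *
          (pressureShift u w q S₁ t y - ∫ z, pressureShift u w q S₁ t z) := by
        funext y; simp [perturbedPressure, sub_eq_add_neg]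
      have e2 : (fun y => pressureShift u w q S₁ t y - ∫ z, pressureShift u w q S₁ t z) =
          fun y => pressureShift u w q S₁ t y + (-∫ z, pressureShift u w q S₁ t z) := by
        funext y; rw [sub_eq_add_neg]
      have hm1 : IsContDiff 1 (fun y => (-1 : ℝ) * (pressureShift u w q S₁ t y - ∫ z, pressureShift u w q S₁ t z)) := by
        have : IsSmooth (fun y => (-1 : ℝ) * (pressureShift u w q S₁ t y - ∫ z, pressureShift u w q S₁ t z)) :=
          contDiff_const.mul (hsht.sub (FunctionSpaces.Torus.isSmooth_const (∫ z, pressureShift u w q S₁ t z)))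
        exact this.isContDiff (by simp)
      rw [e1, gradient_add_apply (hPt.isContDiff (by simp)) hm1, gradient_const_mul_apply hshm, e2,
        gradient_add_apply (hsht.isContDiff (by simp)) (FunctionSpaces.Torus.isContDiff_const _), gradient_const]
      simp [sub_eq_add_neg]
    -- gradient of the shift = the three trace/pressure gradients
    have htrS : IsSmooth (fun z => tensorTrace (S₁ t) z / Fintype.card d) := hSt.tensorTrace.div_const _
    have htrL : IsSmooth (fun z => tensorTrace (linStress (u t) (w t)) z / Fintype.card d) :=
      (hut.linStress hwt).tensorTrace.div_const _
    have eShift : FunctionSpaces.Torus.gradient (pressureShift u w q S₁ t) y =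
        FunctionSpaces.Torus.gradient (q t) y +
          (FunctionSpaces.Torus.gradient (fun z => tensorTrace (S₁ t) z / Fintype.card d) y +
            FunctionSpaces.Torus.gradient (fun z => tensorTrace (linStress (u t) (w t)) z / Fintype.card d) y) := by
      have ePS : pressureShift u w q S₁ t = fun y => q t y + ((fun z => tensorTrace (S₁ t) z / Fintype.card d) y +
          (fun z => tensorTrace (linStress (u t) (w t)) z / Fintype.card d) y) := rfl
      have hsum : IsContDiff 1 (fun y => (fun z => tensorTrace (S₁ t) z / Fintype.card d) y +
          (fun z => tensorTrace (linStress (u t) (w t)) z / Fintype.card d) y) := (htrS.add htrL).isContDiff (by simp)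
      rw [ePS, gradient_add_apply ((hq.isSmooth_slice ht).isContDiff (by simp)) hsum,
        gradient_add_apply (htrS.isContDiff (by simp)) (htrL.isContDiff (by simp))]
    -- divergence of the new stress
    have hT1 : IsSmooth (traceless (S₁ t)) := hSt.traceless
    have hT2 : IsSmooth (traceless (linStress (u t) (w t))) := (hut.linStress hwt).traceless
    have hT3 : IsSmooth (symGrad (w t)) := hwt.symGrad
    have hT4 : IsSmooth (antidivergence (f t)) := isSmooth_antidivergence hft
    have eDiv : tensorDivergence (perturbedStress u w S₁ f t) y =
        (tensorDivergence (S₁ t) y - FunctionSpaces.Torus.gradient (fun z => tensorTrace (S₁ t) z / Fintype.card d) y) +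
        (FunctionSpaces.Torus.convect (u t) (w t) y + FunctionSpaces.Torus.convect (w t) (u t) y -
          FunctionSpaces.Torus.gradient (fun z => tensorTrace (linStress (u t) (w t)) z / Fintype.card d) y) -
        laplacian (w t) y + f t y := by
      have e1 : perturbedStress u w S₁ f t = fun y j => traceless (S₁ t) y j +
          (traceless (linStress (u t) (w t)) y j + ((-1 : ℝ) • symGrad (w t) y j + antidivergence (f t) y j)) := by
        funext y j; simp only [perturbedStress, neg_one_smul]; abel
      have c1 : IsContDiff 1 (fun y j => (-1 : ℝ) • symGrad (w t) y j) := (hT3.smul (-1 : ℝ)).isContDiff (by simp)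
      have c2 : IsContDiff 1 (fun y j => (-1 : ℝ) • symGrad (w t) y j + antidivergence (f t) y j) :=
        c1.add (hT4.isContDiff (by simp))
      have c3 : IsContDiff 1 (fun y j => traceless (linStress (u t) (w t)) y j +
          ((-1 : ℝ) • symGrad (w t) y j + antidivergence (f t) y j)) := (hT2.isContDiff (n := 1) (by simp)).add c2
      rw [e1, tensorDivergence_add_apply (hT1.isContDiff (by simp)) c3,
        tensorDivergence_add_apply (hT2.isContDiff (by simp)) c2, tensorDivergence_add_apply c1 (hT4.isContDiff (by simp)),
        tensorDivergence_const_smul_apply (hT3.isContDiff (by simp)), tensorDivergence_traceless hSt,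
        tensorDivergence_traceless (hut.linStress hwt), tensorDivergence_linStress hut hwt (h.divFree t ht) (hwdiv t ht),
        tensorDivergence_symGrad hwt (hwdiv t ht), tensorDivergence_antidivergence hd hft, hfmean t ht]
      simp only [neg_smul, one_smul, sub_zero]
      abel
    -- assemble
    have hUeq := h.momentum t ht y
    have hW := hid t ht y
    rw [eDt, eLap, eConv, eGrad, eShift, eDiv]
    rw [one_smul] at hUeq ⊢
    set Du := FunctionSpaces.Torus.timeDerivWithin (Icc 0 T) u t y
    set Dw := FunctionSpaces.Torus.timeDerivWithin (Icc 0 T) w t y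
    set Cuu := FunctionSpaces.Torus.convect (u t) (u t) y
    set Cuw := FunctionSpaces.Torus.convect (u t) (w t) y
    set Cwu := FunctionSpaces.Torus.convect (w t) (u t) y
    set Cww := FunctionSpaces.Torus.convect (w t) (w t) y
    set GP := FunctionSpaces.Torus.gradient (P t) y
    set Gq := FunctionSpaces.Torus.gradient (q t) y
    set G1 := FunctionSpaces.Torus.gradient (fun z => tensorTrace (S₁ t) z / Fintype.card d) y
    set G2 := FunctionSpaces.Torus.gradient (fun z => tensorTrace (linStress (u t) (w t)) z / Fintype.card d) y
    set Lu := laplacian (u t) y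
    set Lw := laplacian (w t) y
    set DR := tensorDivergence (R t) y
    set DS := tensorDivergence (S₁ t) y
    set F := f t y
    have eww : tensorDivergence (tensorProd (w t) (w t)) y = Cww := by
      rw [tensorDivergence_tensorProd hwt hwt, hwdiv t ht y, zero_smul, add_zero]
    rw [eww] at hW
    -- `hUeq : Du + Cuu + GP = Lu + DR`, `hW : Dw + Cww + DR = DS + Gq + F`
    have key : Du + Dw + (Cuu + Cuw + (Cwu + Cww)) + (GP - (Gq + (G1 + G2))) -
        (Lu + Lw + (DS - G1 + (Cuw + Cwu - G2) - Lw + F)) =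
        (Du + Cuu + GP - (Lu + DR)) + (Dw + Cww + DR - (DS + Gq + F)) := by abel
    rw [hUeq, hW, sub_self, sub_self, add_zero, sub_eq_zero] at key
    exact key
  · -- symmetry
    intro t ht y i j
    have h1w : IsContDiff 1 (w t) := (hw.isSmooth_slice ht).isContDiff (by simp)
    simp only [perturbedStress, PiLp.add_apply, PiLp.sub_apply]
    rw [traceless_symm (hSsym t ht y) i j, traceless_symm (fun i j => linStress_symm (u t) (w t) y i j) i j,
      symGrad_symm h1w y i j, antidivergence_symm (hf.isSmooth_slice ht) y j i]
  · -- trace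
    intro t ht y
    have h1w : IsContDiff 1 (w t) := (hw.isSmooth_slice ht).isContDiff (by simp)
    simp only [perturbedStress, PiLp.add_apply, PiLp.sub_apply, Finset.sum_add_distrib, Finset.sum_sub_distrib,
      sum_traceless_apply_apply, symGrad_trace h1w, hwdiv t ht y, antidivergence_trace hd (hf.isSmooth_slice ht)]
    simp
  · -- zero mean of the pressure
    intro t ht
    have hsht : IsSmooth (pressureShift u w q S₁ t) := hsh.isSmooth_slice ht
    have z1 : HasZeroMean (fun y => pressureShift u w q S₁ t y - ∫ z, pressureShift u w q S₁ t z) :=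
      hasZeroMean_sub_integral hsht.integrable
    exact HasZeroMean.sub (h.hasZeroMean_pressure t ht) z1 (h.smooth_pressure.isSmooth_slice ht).integrable
      (hsht.sub (FunctionSpaces.Torus.isSmooth_const _)).integrable

/-- **The new stress vanishes at times where the perturbation data vanish**: if `w t = 0`,
`S₁ t = 0` and `f t = 0` then `perturbedStress u w S₁ f t = 0` (used for well-preparedness,
CL22 Lemma 4.6: "`w^{(p)}, w^{(c)} = 0` whenever `dist(t, I^c) ≤ τ`"). [cite: CheskidovLuo2022, §4.5 Lemma 4.6] -/
theorem perturbedStress_eq_zero {t : ℝ} (hw0 : ∀ y, w t y = 0) (hS0 : ∀ y, S₁ t y = 0) (hf0 : ∀ y, f t y = 0)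
    (y : UnitAddTorus d) : perturbedStress u w S₁ f t y = 0 := by
  have ew : w t = fun _ => 0 := funext hw0
  have ef : f t = 0 := funext hf0
  have htr0 : ∀ {A : UnitAddTorus d → d → EuclideanSpace ℝ d}, (∀ y, A y = 0) → traceless A y = 0 := by
    intro A hA; funext j; simp [traceless, tensorTrace, hA y]
  have hL0 : ∀ y, linStress (u t) (w t) y = 0 := by
    intro z; funext j; simp [linStress, tensorProd, ew]
  have hG0 : symGrad (w t) y = 0 := by
    funext j
    simp only [symGrad, ew, Pi.zero_apply]
    rw [partialDeriv_const_apply, gradient_const]; simp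
  funext j
  simp only [perturbedStress, htr0 hS0, htr0 hL0, hG0, ef, antidivergence_zero, Pi.zero_apply]
  simp

/-- **Pointwise size of the new stress**:
`‖R₁‖ ≤ 2‖S₁‖ + 4‖u‖‖w‖ + 2∑ᵢ‖∂ᵢw‖ + ‖ℛf‖`. [folklore] -/
theorem norm_perturbedStress_le {t : ℝ} (hwt : IsContDiff 1 (w t)) (y : UnitAddTorus d) :
    ‖perturbedStress u w S₁ f t y‖ ≤ 2 * ‖S₁ t y‖ + 4 * ‖u t y‖ * ‖w t y‖ +
      2 * ∑ i, ‖FunctionSpaces.Torus.partialDeriv i (w t) y‖ + ‖antidivergence (f t) y‖ := by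
  have e : perturbedStress u w S₁ f t y = traceless (S₁ t) y + traceless (linStress (u t) (w t)) y -
      symGrad (w t) y + antidivergence (f t) y := by funext j; simp [perturbedStress]
  rw [e]
  have h1 := norm_traceless_le (S₁ t) y
  have h2 := (norm_traceless_le (linStress (u t) (w t)) y).trans
    (mul_le_mul_of_nonneg_left (norm_linStress_le (u t) (w t) y) (by norm_num))
  have h3 := norm_symGrad_le hwt y
  calc ‖traceless (S₁ t) y + traceless (linStress (u t) (w t)) y - symGrad (w t) y + antidivergence (f t) y‖
      ≤ ‖traceless (S₁ t) y + traceless (linStress (u t) (w t)) y - symGrad (w t) y‖ + ‖antidivergence (f t) y‖ :=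
        norm_add_le _ _
    _ ≤ ‖traceless (S₁ t) y + traceless (linStress (u t) (w t)) y‖ + ‖symGrad (w t) y‖ + ‖antidivergence (f t) y‖ := by
        gcongr; exact norm_sub_le _ _
    _ ≤ ‖traceless (S₁ t) y‖ + ‖traceless (linStress (u t) (w t)) y‖ + ‖symGrad (w t) y‖ + ‖antidivergence (f t) y‖ := by
        gcongr; exact norm_add_le _ _
    _ ≤ _ := by linarith

end Perturb

end Torus

end Literature.Analysis.FluidPDE
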